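import Literature.NumberTheory.Sieve.ChenShiftSeq
import Literature.NumberTheory.Sieve.ChenTheoremIUpperSieveTools
import HarnessLib

/-!
# Chen's Theorem II: the sequences `(𝒜'_h)_q` and the counts `S(𝒜_h(x)_q, z)`

Companion of `ChenShiftSeq.lean` (the shifted sifted sequence `𝒜'_h(x) = {p + h : h < p ≤ x}` as a
`SieveSequence`). For the upper bound (B) of `ChenShiftedAssembly`
(`∑_{x^{1/10} ≤ q < y} S(𝒜_h(x)_q, ⌈x^{1/10}⌉)`, Chen Jing-run, Sci. Sinica 16 (1973), Lemma 9, (32),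
for the sequence `{p + h}`), the linear sieve is applied, for each prime `q` of the window, to the
sub-sequence of the multiples of `q`, `(chenShiftSeq h x).restrictDvd q` (`SieveSequence.restrictDvd`:
weights `1_{q ∣ n} a(n)`, size `g(q) π(x)`, same density). This file is the dictionary for that step —
a transcription of the corresponding lemmas of `ChenTheoremIUpperSieveTools` for the Goldbach
sequence `(chenGoldbachSeq x).restrictDvd q` — and the passage from `𝒜'_h` back to `𝒜_h`:

* `sifted_restrictDvd_chenShiftSeq` — `S((𝒜')_q, P(z); x + h) = roughMultCount (shiftSieveSet' h x) ⌈z⌉ q`;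
* `densityProduct_restrictDvd_chenShiftSeq`, `size_restrictDvd_chenShiftSeq`,
  `remainder_restrictDvd_chenShiftSeq` (`r_q(d) = r(qd)` for `d ∣ P(z)`, `q ≥ ⌈z⌉` prime);
* `roughMultCount_shiftSieveSet_le` — for `2h < Z` the `Z`-rough multiples of `q` in `𝒜_h(x)` all lie in
  `𝒜'_h(x)` (an element `p + h` with `p ≤ h` is `< Z` and has a prime factor `< Z`);
* `roughMultCount_le_div` — the trivial bound `S(𝒜_q, z) ≤ #{n ≤ x + h : q ∣ n} = ⌊(x + h)/q⌋`.

No named facts, no definitions.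

## References

* Chen Jing-run, Sci. Sinica 16 (1973) 157–176, Lemma 9 (32) and §III (reprint: Wang Yuan (ed.),
  *Goldbach Conjecture*, 1984, PDF pp. 167–168). [ChenSciSinica1973]
* M. B. Nathanson, *Additive Number Theory: The Classical Bases*, GTM 164 (1996), §10.5 (the
  sequences `A_q`). [Nathanson1996]
-/

open Finset Filter

noncomputable section

namespace Literature.NumberTheory.Sieve.Chen

open SieveSequence ChenSieve

/-! ### The sequences `(𝒜'_h)_q = (chenShiftSeq h x).restrictDvd q` -/

/-- **`S((𝒜')_q, P(z); x + h) = S(𝒜'_h(x)_q, ⌈z⌉)`** (`roughMultCount`): sifting the sub-sequence of the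
multiples of `q` by all primes `< z` counts the elements of `𝒜'_h(x)` divisible by `q` with no prime
factor `< z` (as in `sifted_chenShiftSeq`). [cite: Nathanson1996, §10.2 (the sequence A_q)] -/
theorem sifted_restrictDvd_chenShiftSeq (h x q : ℕ) (z : ℝ) :
    ((chenShiftSeq h x).restrictDvd q).sifted ((x + h : ℕ) : ℝ) (primesProdBelow z) =
      roughMultCount (shiftSieveSet' h x) ⌈z⌉₊ q := by
  classical
  rw [SieveSequence.sifted, Nat.floor_natCast]
  have h1 : ∑ n ∈ (Ioc 0 (x + h)).filter (fun n : ℕ => n.Coprime (primesProdBelow z)),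
      ((chenShiftSeq h x).restrictDvd q).a n =
      ∑ n ∈ (Ioc 0 (x + h)).filter (fun n : ℕ => n.Coprime (primesProdBelow z) ∧ q ∣ n),
        chenShiftWeight h x n := by
    symm
    rw [← Finset.filter_filter, Finset.sum_filter]
    refine Finset.sum_congr rfl fun n _ => ?_
    simp only [SieveSequence.restrictDvd_a]
    split_ifs <;> rfl
  have h2 : ((Ioc 0 (x + h)).filter (fun n : ℕ => n.Coprime (primesProdBelow z) ∧ q ∣ n)).filter
      (fun n => n ∈ shiftSieveSet' h x) =
      (shiftSieveSet' h x).filter (fun n => q ∣ n ∧ IsRough ⌈z⌉₊ n) := by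
    ext n
    simp only [Finset.mem_filter, Finset.mem_Ioc]
    constructor
    · rintro ⟨⟨hn0, hcop, hq⟩, hn⟩
      have hn0' : n ≠ 0 := by omega
      exact ⟨hn, hq, (coprime_primesProdBelow_iff_isRough hn0').mp hcop⟩
    · rintro ⟨hn, hq, hr⟩
      have hnI := shiftSieveSet'_subset_Ioc h x hn
      rw [Finset.mem_Ioc] at hnI
      have hn0' : n ≠ 0 := by omega
      exact ⟨⟨⟨hnI.1, hnI.2⟩, (coprime_primesProdBelow_iff_isRough hn0').mpr hr, hq⟩, hn⟩
  rw [h1, sum_chenShiftWeight, h2, roughMultCount]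

/-- `V(P(z))` for `(𝒜')_q` is `V_h(z)` (the density of `(𝒜')_q` is that of `𝒜'`). [cite: Nathanson1996, (10.8)] -/
theorem densityProduct_restrictDvd_chenShiftSeq (h x q : ℕ) (z : ℝ) :
    ((chenShiftSeq h x).restrictDvd q).densityProduct (primesProdBelow z) = sieveProduct h z :=
  densityProduct_chenShiftSeq h x z

/-- The size of `(𝒜')_q` is `g(q) π(x)` (definition of `restrictDvd`). [folklore] -/
theorem size_restrictDvd_chenShiftSeq (h x q : ℕ) (t : ℝ) :
    ((chenShiftSeq h x).restrictDvd q).size t =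
      shiftedPrimesDensity h q * (Nat.primeCounting x : ℝ) :=
  rfl

/-- **`r_q(d) = r(qd)`** (Nathanson p. 173): for a prime `q ≥ ⌈z⌉` and `d ∣ P(z)` (so `(q, d) = 1`), the
remainder of `(𝒜')_q` at `d` is the remainder of `𝒜'` at `qd` (`g` multiplicative).
[cite: Nathanson1996, §10.5 (proof of Thm 10.5, p. 173)] -/
theorem remainder_restrictDvd_chenShiftSeq {h x q d : ℕ} {z : ℝ} (hq : q.Prime) (hqz : ⌈z⌉₊ ≤ q)
    (hd : d ∣ primesProdBelow z) (t : ℝ) :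
    ((chenShiftSeq h x).restrictDvd q).remainder d t = (chenShiftSeq h x).remainder (q * d) t := by
  have hcop : q.Coprime d := coprime_of_ceil_le_of_dvd_primesProdBelow hq hqz hd
  rw [SieveSequence.remainder, SieveSequence.remainder, restrictDvd_congrSum _ hcop,
    (chenShiftSeq h x).density_mult.map_mul_of_coprime hcop]
  change (chenShiftSeq h x).congrSum (q * d) t -
      (chenShiftSeq h x).density d * ((chenShiftSeq h x).density q * (chenShiftSeq h x).size t) =
    (chenShiftSeq h x).congrSum (q * d) t -
      (chenShiftSeq h x).density q * (chenShiftSeq h x).density d * (chenShiftSeq h x).size t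
  ring

/-! ### From `𝒜'_h` back to `𝒜_h`, and the trivial bound -/

/-- For `2h < Z`, the `Z`-rough multiples of `q` in `𝒜_h(x)` lie in `𝒜'_h(x)`: an element `p + h` with
`p ≤ h` is `≤ 2h < Z` and `≥ 2`, so its least prime factor is `< Z`. Hence
`S(𝒜_h(x)_q, Z) ≤ S(𝒜'_h(x)_q, Z)`. [folklore] -/
theorem roughMultCount_shiftSieveSet_le {h x Z : ℕ} (hZ : 2 * h < Z) (q : ℕ) :
    roughMultCount (shiftSieveSet h x) Z q ≤ roughMultCount (shiftSieveSet' h x) Z q := by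
  classical
  rw [roughMultCount, roughMultCount]
  refine Finset.card_le_card fun n hn => ?_
  rw [Finset.mem_filter] at hn ⊢
  obtain ⟨hnA, hq, hr⟩ := hn
  obtain ⟨p, hp, hpx, rfl⟩ := mem_shiftSieveSet.mp hnA
  refine ⟨mem_shiftSieveSet'.mpr ⟨p, hp, ?_, hpx, rfl⟩, hq, hr⟩
  rcases lt_or_ge h p with hlt | hle
  · exact hlt
  · exfalso
    have hp2 := hp.two_le
    have hn1 : p + h ≠ 1 := by omega
    have hmem : (p + h).minFac ∈ (p + h).primeFactors :=
      Nat.mem_primeFactors.mpr ⟨Nat.minFac_prime hn1, Nat.minFac_dvd _, by omega⟩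
    have hZle : Z ≤ (p + h).minFac := hr _ hmem
    have hmin : (p + h).minFac ≤ p + h := Nat.minFac_le (by omega)
    omega

/-- The trivial bound `S(𝒜_h(x)_q, Z) ≤ ⌊(x + h)/q⌋` (the multiples of `q` in `(0, x + h]`). [folklore] -/
theorem roughMultCount_le_div (h x Z q : ℕ) :
    roughMultCount (shiftSieveSet h x) Z q ≤ (x + h) / q := by
  classical
  rw [roughMultCount]
  calc #((shiftSieveSet h x).filter fun n => q ∣ n ∧ IsRough Z n)
      ≤ #((shiftSieveSet h x).filter fun n => q ∣ n) :=
        Finset.card_le_card (Finset.monotone_filter_right _ fun n _ hn => hn.1)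
    _ ≤ (x + h) / q := card_filter_dvd_le (shiftSieveSet_subset_Ioc h x)

end Literature.NumberTheory.Sieve.Chen
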